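import Summits.HubbardSuperconductivity.HubbardSuperconductivity.Theorems.FunctionFieldCertificateWindowInfraredBoundReductions
import Literature.MathematicalPhysics.QuantumLattice.PairFieldMomentum
-- (remark only) Literature.MathematicalPhysics.QuantumLattice.MagneticHubbardTorusGauge: phaseGauge, isGroundStateInSector_phaseGauge_conj_iff

/-!
# Sketch — crux-ideate stmt-HubbardSuperconductivity-1089 (`WindowInfraredBound`), ideator 2, round 1

First-lemma signatures of the two idea cards (they must ELABORATE; proofs are not claimed here):

* card `dyadic-halving-cascade`: `lpTent`, `shellSum`, hypothesis `DyadicHalving`, the pure cascade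
  lemma `cascade_bound`, the local partition of unity `lpTent_add_lpTent_two_mul`, and the line's
  composition `wib_of_dyadicHalving : DyadicHalving → WindowInfraredBound`.
* card `single-mode-pdw-subcriticality`: hypothesis `SingleModeCoercivity` (a one-parameter family of
  sector operator inequalities), `goldstoneShape_of_singleModeCoercivity` (GS-evaluation, provable now)
  and `wib_of_singleModeCoercivity` (composition with the landed `wib_of_goldstoneShape`).
-/

set_option linter.dupNamespace false

noncomputable section

namespace Summit.HubbardSuperconductivity.HubbardSuperconductivity.Cruxes.WindowInfraredBound.Ideator2

open Literature.MathematicalPhysics.QuantumLattice Literature.Probability.LatticeModels Matrix Finset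
open Summit.HubbardSuperconductivity.HubbardSuperconductivity.Theses

/-! ## Card 1: dyadic halving cascade -/

/-- Littlewood–Paley log-tent `φ(u) = max 0 (1 − |log₂ u|)`, supported on `[1/2, 2]`,
with `Σ_{k ∈ ℤ} φ(2^k u) = 1` for `u > 0`. -/
def lpTent (u : ℝ) : ℝ := max 0 (1 - |Real.logb 2 u|)

/-- Smooth dyadic shell sum of the `d`-wave pair structure factor at scale `ρ`:
`T^φ_ψ(ρ) = Σ_{m ≠ 0} φ(|q_m|/ρ) S_ψ(m)`. -/
def shellSum (L : ℕ) [NeZero L] (ψ : Fock (Orb (FermionTorus 2 L))) (ρ : ℝ) : ℝ :=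
  ∑ m : TorusSite 2 L, if m ≠ 0 then
    lpTent (Real.sqrt (momentumNormSq L m) / ρ) * pairStructureFactor dWaveFormFactor L ψ m else 0

/-- **(Dbl) dyadic halving**: in every normalised sector ground state, halving the scale at most halves
the smooth shell pair weight, up to a flat defect `B₁ρ²L²` and a bottom-of-spectrum defect `B₂L`. -/
def DyadicHalving : Prop :=
  ∀ U : ℝ, 0 < U → ∀ δ ∈ Set.Ioo (0:ℝ) (1 / 2), ∃ B₁ B₂ ε₀ : ℝ, 0 ≤ B₁ ∧ 0 ≤ B₂ ∧ 0 < ε₀ ∧ ∃ L₀ : ℕ,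
    ∀ (L : ℕ) [NeZero L], L₀ ≤ L → Even L → ∀ ψ : Fock (Orb (FermionTorus 2 L)), star ψ ⬝ᵥ ψ = 1 →
      IsGroundStateInSector (hubbardTorus 2 L 1 U) (2 * ⌊(1 - δ) * (L : ℝ) ^ 2 / 2⌋₊) 0 ψ →
        ∀ ρ ∈ Set.Ioc (0:ℝ) (ε₀ / 2),
          shellSum L ψ ρ ≤ shellSum L ψ (2 * ρ) / 2 + B₁ * ρ ^ 2 * (L : ℝ) ^ 2 + B₂ * (L : ℝ)

/-- Pure cascade lemma (real analysis), in the closed form the line needs: a halving recursion with a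
flat defect `a/4^{k+1}` (from `B₁ρ_{k+1}²L²`, `ρ_k = ε₀2^{-k}`) and a constant defect `b` (from `B₂L`) sums to
`f k ≤ (M + a)/2^k + 2b`. Proved via the sharper invariant `f k ≤ M/2^k + a·2^{-k}(1 − 2^{-k}) + 2b(1 − 2^{-k})`. -/
theorem cascade_bound {f : ℕ → ℝ} {M a b : ℝ} (ha : 0 ≤ a) (hb : 0 ≤ b) (h0 : f 0 ≤ M)
    (hstep : ∀ k, f (k + 1) ≤ f k / 2 + a / 4 ^ (k + 1) + b) (k : ℕ) :
    f k ≤ (M + a) / 2 ^ k + 2 * b := by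
  -- sharper invariant
  have key : ∀ k : ℕ, f k ≤ M / 2 ^ k + a * (1 / 2 ^ k) * (1 - 1 / 2 ^ k) + 2 * b * (1 - 1 / 2 ^ k) := by
    intro k
    induction k with
    | zero => simpa using h0
    | succ n ih =>
      have h2 : (0 : ℝ) < 2 ^ n := pow_pos two_pos n
      have hs := hstep n
      have e4 : (4 : ℝ) ^ (n + 1) = (2 ^ (n + 1)) ^ 2 := by
        rw [← pow_mul, show (4 : ℝ) = 2 ^ 2 by norm_num, ← pow_mul, mul_comm]
      rw [e4] at hs
      have e2 : (2 : ℝ) ^ (n + 1) = 2 * 2 ^ n := by rw [pow_succ, mul_comm]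
      rw [e2] at hs ⊢
      -- everything in terms of t = 1/2^n
      set t : ℝ := 1 / 2 ^ n with ht
      have ht0 : 0 < t := by rw [ht]; positivity
      have ht1 : t ≤ 1 := by
        rw [ht, div_le_one h2]; exact one_le_pow₀ (by norm_num)
      have hM : M / 2 ^ n = M * t := by rw [ht]; field_simp
      have hM' : M / (2 * 2 ^ n) = M * t / 2 := by rw [ht]; field_simp
      have hq : (1 : ℝ) / (2 * 2 ^ n) = t / 2 := by rw [ht]; field_simp
      have hq2 : a / (2 * 2 ^ n) ^ 2 = a * t ^ 2 / 4 := by rw [ht]; field_simp; ring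
      rw [hM] at ih
      rw [hM', hq]
      rw [hq2] at hs
      nlinarith [ih, hs, ht0, ht1, ha, hb, sq_nonneg t]
  have h2k : (0 : ℝ) < 2 ^ k := pow_pos two_pos k
  have hk := key k
  have ht1 : (1 : ℝ) / 2 ^ k ≤ 1 := by
    rw [div_le_one h2k]; exact one_le_pow₀ (by norm_num)
  have ht0 : (0 : ℝ) < 1 / 2 ^ k := by positivity
  rw [add_div, div_eq_mul_one_div M, div_eq_mul_one_div a]
  rw [div_eq_mul_one_div M] at hk
  set t : ℝ := 1 / 2 ^ k with ht
  have h1 : 0 ≤ a * (t * t) := mul_nonneg ha (mul_nonneg ht0.le ht0.le)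
  have h2 : 0 ≤ b * t := mul_nonneg hb ht0.le
  nlinarith [hk, h1, h2]

/-- Local partition of unity of the log-tent: `φ(u) + φ(2u) = 1` on `[1/2, 1]`. -/
theorem lpTent_add_lpTent_two_mul {u : ℝ} (hu : u ∈ Set.Icc (1 / 2 : ℝ) 1) :
    lpTent u + lpTent (2 * u) = 1 := by
  obtain ⟨hu1, hu2⟩ := hu
  have hupos : 0 < u := by linarith
  have hlog2 : Real.logb 2 (2 * u) = 1 + Real.logb 2 u := by
    rw [Real.logb_mul (by norm_num) hupos.ne', Real.logb_self_eq_one (by norm_num)]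
  -- `log₂ u ∈ [-1, 0]`
  have hle : Real.logb 2 u ≤ 0 := Real.logb_nonpos (by norm_num) hupos.le hu2
  have hge : -1 ≤ Real.logb 2 u := by
    have : Real.logb 2 (1 / 2) ≤ Real.logb 2 u := Real.logb_le_logb_of_le (by norm_num) (by norm_num) hu1
    have h12 : Real.logb 2 (1 / 2) = -1 := by
      rw [one_div, Real.logb_inv, Real.logb_self_eq_one (by norm_num)]
    linarith
  unfold lpTent
  rw [hlog2, abs_of_nonpos hle, abs_of_nonneg (by linarith), max_eq_right (by linarith),
    max_eq_right (by linarith)]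
  ring

/-- The UV anchor is free: `shellSum L ψ ρ ≤ Σ_m S_ψ(m) ≤ 32 L²` for every normalised Fock vector
(landed Parseval ceiling `wib_sum_pairStructureFactor_le`, and `0 ≤ φ ≤ 1`). -/
theorem lpTent_nonneg (u : ℝ) : 0 ≤ lpTent u := le_max_left _ _

theorem lpTent_le_one (u : ℝ) : lpTent u ≤ 1 :=
  max_le zero_le_one (by linarith [abs_nonneg (Real.logb 2 u)])

theorem shellSum_le_apriori (L : ℕ) [NeZero L] (ρ : ℝ) (ψ : Fock (Orb (FermionTorus 2 L)))
    (hψ : star ψ ⬝ᵥ ψ = 1) : shellSum L ψ ρ ≤ 32 * (L : ℝ) ^ 2 := by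
  refine le_trans (Finset.sum_le_sum fun m _ => ?_) (Theorems.wib_sum_pairStructureFactor_le L ψ hψ)
  split_ifs
  · calc lpTent (Real.sqrt (momentumNormSq L m) / ρ) * pairStructureFactor dWaveFormFactor L ψ m
        ≤ 1 * pairStructureFactor dWaveFormFactor L ψ m :=
          mul_le_mul_of_nonneg_right (lpTent_le_one _) (pairStructureFactor_nonneg _ _ _ _)
      _ = pairStructureFactor dWaveFormFactor L ψ m := one_mul _
  · exact pairStructureFactor_nonneg _ _ _ _

/-- **The line's composition**: dyadic halving, anchored by the Parseval ceiling, implies the crux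
(geometric series over scales `ρ_k = ε₀ 2^{-k}`, window indicator dominated by the shells `ρ_k ≤ 2ε`). -/
theorem wib_of_dyadicHalving (h : DyadicHalving) : KacWindowPenalty.WindowInfraredBound := by
  sorry

/-! ## Card 2: single-mode PDW subcriticality (sector operator-inequality family) -/

/-- **(OpIR) single-mode coercivity**: for every window momentum `q_m`, on the sector `(N_L, S^z = 0)`,
`H − E₀ ⪰ (|q_m|² / (2 C L²)) · (Δ_d(m)ᴴ Δ_d(m) − (A/|q_m|) L²)` as quadratic forms. -/
def SingleModeCoercivity : Prop :=
  ∀ U : ℝ, 0 < U → ∀ δ ∈ Set.Ioo (0:ℝ) (1 / 2), ∃ A C ε₀ : ℝ, 0 ≤ A ∧ 0 < C ∧ 0 < ε₀ ∧ ∃ L₀ : ℕ,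
    ∀ (L : ℕ) [NeZero L], L₀ ≤ L → Even L → ∀ m : TorusSite 2 L, m ≠ 0 → momentumNormSq L m ≤ ε₀ ^ 2 →
      ∀ φ : Fock (Orb (FermionTorus 2 L)),
        φ ∈ szSector (Λ := FermionTorus 2 L) (2 * ⌊(1 - δ) * (L : ℝ) ^ 2 / 2⌋₊) 0 →
          momentumNormSq L m / (2 * C * (L : ℝ) ^ 2) *
              ((star (pairFieldAt dWaveFormFactor L m *ᵥ φ) ⬝ᵥ (pairFieldAt dWaveFormFactor L m *ᵥ φ)).re
                - A / Real.sqrt (momentumNormSq L m) * (L : ℝ) ^ 2 * (star φ ⬝ᵥ φ).re) ≤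
            (star φ ⬝ᵥ (hubbardTorus 2 L 1 U *ᵥ φ)).re -
              (hubbardTorus 2 L 1 U).minEnergyOn
                  (szSector (Λ := FermionTorus 2 L) (2 * ⌊(1 - δ) * (L : ℝ) ^ 2 / 2⌋₊) 0) *
                (star φ ⬝ᵥ φ).re

/-- **GS-evaluation** (provable now): at a normalised sector ground state the right-hand side of
`SingleModeCoercivity` vanishes, giving the pointwise Goldstone shape `S_ψ(m)·|q_m| ≤ A`. -/
theorem goldstoneShape_of_singleModeCoercivity (h : SingleModeCoercivity) :
    ∀ U : ℝ, 0 < U → ∀ δ ∈ Set.Ioo (0:ℝ) (1 / 2), ∃ A ε₀ : ℝ, 0 ≤ A ∧ 0 < ε₀ ∧ ∃ L₀ : ℕ,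
      ∀ (L : ℕ) [NeZero L], L₀ ≤ L → Even L → ∀ ψ : Fock (Orb (FermionTorus 2 L)),
        star ψ ⬝ᵥ ψ = 1 →
          IsGroundStateInSector (hubbardTorus 2 L 1 U) (2 * ⌊(1 - δ) * (L : ℝ) ^ 2 / 2⌋₊) 0 ψ →
            ∀ m : TorusSite 2 L, m ≠ 0 → momentumNormSq L m ≤ ε₀ ^ 2 →
              pairStructureFactor dWaveFormFactor L ψ m * Real.sqrt (momentumNormSq L m) ≤ A := by
  intro U hU δ hδ
  obtain ⟨A, C, ε₀, hA, hC, hε₀, L₀, hmain⟩ := h U hU δ hδ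
  refine ⟨A, ε₀, hA, hε₀, L₀, fun L _ hL hev ψ hψ1 hgs m hm hwin => ?_⟩
  obtain ⟨hmem, -, heig⟩ := hgs
  have hLpos : (0 : ℝ) < (L : ℝ) := Nat.cast_pos.2 (Nat.pos_of_ne_zero (NeZero.ne L))
  have hL2 : (0 : ℝ) < (L : ℝ) ^ 2 := by positivity
  -- `|q_m|² > 0`
  have hμ : 0 < momentumNormSq L m :=
    lt_of_le_of_ne (momentumNormSq_nonneg (L := L) m) (fun h0 => hm ((momentumNormSq_eq_zero_iff (L := L) m).1 h0.symm))
  have hsq : 0 < Real.sqrt (momentumNormSq L m) := Real.sqrt_pos.2 hμ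
  -- GS-evaluation: the right-hand side vanishes at `φ = ψ`
  have hR : (star ψ ⬝ᵥ (hubbardTorus 2 L 1 U *ᵥ ψ)).re -
      (hubbardTorus 2 L 1 U).minEnergyOn
        (szSector (Λ := FermionTorus 2 L) (2 * ⌊(1 - δ) * (L : ℝ) ^ 2 / 2⌋₊) 0) * (star ψ ⬝ᵥ ψ).re = 0 := by
    rw [heig, dotProduct_smul, hψ1, smul_eq_mul, mul_one, Complex.ofReal_re, Complex.one_re, mul_one, sub_self]
  have hineq := hmain L hL hev m hm hwin ψ hmem
  rw [hR, hψ1, Complex.one_re, mul_one] at hineq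
  -- divide out the positive coefficient `|q_m|² / (2 C L²)`
  have hκ : 0 < momentumNormSq L m / (2 * C * (L : ℝ) ^ 2) := by positivity
  have hX : (star (pairFieldAt dWaveFormFactor L m *ᵥ ψ) ⬝ᵥ (pairFieldAt dWaveFormFactor L m *ᵥ ψ)).re
      ≤ A / Real.sqrt (momentumNormSq L m) * (L : ℝ) ^ 2 := by
    have := (mul_nonpos_iff.1 hineq)
    rcases this with ⟨h1, h2⟩ | ⟨h1, h2⟩
    · linarith
    · exact absurd h1 (not_le.2 hκ)
  -- translate to the structure factor
  rw [pairStructureFactor_apply, div_mul_eq_mul_div, div_le_iff₀ hL2]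
  calc (star (pairFieldAt dWaveFormFactor L m *ᵥ ψ) ⬝ᵥ (pairFieldAt dWaveFormFactor L m *ᵥ ψ)).re *
        Real.sqrt (momentumNormSq L m)
      ≤ A / Real.sqrt (momentumNormSq L m) * (L : ℝ) ^ 2 * Real.sqrt (momentumNormSq L m) :=
        mul_le_mul_of_nonneg_right hX hsq.le
    _ = A * (L : ℝ) ^ 2 := by field_simp

/-- **The line's composition**: single-mode coercivity ⇒ Goldstone shape ⇒ the crux
(`wib_of_goldstoneShape`, landed, then the `Iff.rfl` between the two route copies). -/
theorem wib_of_singleModeCoercivity (h : SingleModeCoercivity) : KacWindowPenalty.WindowInfraredBound :=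
  Theorems.wib_functionField_iff_kac.1
    (Theorems.wib_of_goldstoneShape (goldstoneShape_of_singleModeCoercivity h))

/-! ## Remark (boost identity, used in card 2's adversary analysis): the site-phase unitary
`phaseGauge g`, `g(x) = exp(iπ m·x/L)`, conjugates `Δ_d(m)` to a `k = 0` pair field with distorted form
factor and maps sector ground states of `H` to those of `W H Wᴴ` (tree:
`isGroundStateInSector_phaseGauge_conj_iff`, `phaseGauge_mulVec_mem_szSector`). Not restated here. -/

end Summit.HubbardSuperconductivity.HubbardSuperconductivity.Cruxes.WindowInfraredBound.Ideator2

end
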